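import Mathlib
import Literature.NumberTheory.Sieve.ShiuTheoremProofs
import Literature.NumberTheory.Sieve.PolynomialValuesSieveSequence
import Literature.NumberTheory.Sieve.SieveFrameworkUpperBound
import Literature.NumberTheory.Sieve.BoundedClassDensitySieveDimension
import Literature.NumberTheory.Sieve.PolynomialCongruencesMeanValues
import Literature.NumberTheory.Sieve.DivisorBound
import Literature.NumberTheory.LFunctions.MertensElementary
import Summits.Parity.BatemanHorn.Theorems.AlmostPrimeZerosSystemMertensCounting
import HarnessLib

/-!
# Nair–Tenenbaum light, II: the local factors `θ_p = p/(p − ρ(p))` and `h(c) = ∏_{p∣c} θ_p`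

Crux `SystemLSDRealSegment` (stmt-Parity-11292, route `AlmostPrimeZeros`), line `beta-thinned-root-kernel`,
support programme of the lead c8: **Nair–Tenenbaum "light"** — the sharp-order upper bound
`Σ_{1≤n≤N} G(F(n)) ≤ C · N · exp(Σ_{p≤N} (G(p) − 1) ρ_F(p)/p)` for a polynomial `F ∈ ℤ[X]` (degree `≥ 1`, positive on
`ℕ_{≥1}`, root counts `ρ_F(p) ≤ D`, `ρ_F(p) < p`, `ρ_F(p^a) ≤ M`) and every weight `G ≥ 0`, `G(1) = 1`, multiplicative on
coprime arguments with `G(p^v) ≤ A` (M. Nair, Acta Arith. 62 (1992); Nair–Tenenbaum, Acta Math. 180 (1998), Thm 1 —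
the special case of the class bounded at prime powers), by Shiu's method (J. reine angew. Math. 313 (1980), §5) run on the
values `m = F(n)`: cut `m = c·d` at `√N` (`Shiu.cutPrime/cPart/dPart`), four classes, the beta upper-bound sieve of dimension
`2D` on the root classes of `c`, Hall–Tenenbaum's Theorem 01 and Rankin's trick with a uniform exponent for the `c`-sums.
Applied (file `…NairUpperBound`) to the product polynomial of a Bateman–Horn system with `G = y^{capped}` it gives
`Σ_{n≤x} y^{s_f(n)} ≪ x (log x)^{k(y−1)}`, i.e. `H_x(y) = O(1)` on the real segment — the upper half of the order of
magnitude predicted by the crux (lower half: `sumPowStat_lower_bound`, landed).  Everything here is PROVED; no definitions.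

This file: bounds `1 ≤ θ_p ≤ 4D+2`, `θ_p − 1 ≤ (4D+2)ρ(p)/p`, multiplicativity of `h`, and `∏_{p<w, p∤c}(1−ρ(p)/p) ≤ V(w) h(c)`.
-/

open Finset Real Polynomial

namespace Summit.Parity.BatemanHorn.Cruxes.SystemLSDRealSegment.BetaThinnedRootKernel.Nair

open Literature.NumberTheory.Sieve

noncomputable section

/-! ## Part A'. The local factors `θ_p = p/(p − ρ(p))`, `h(c) = ∏_{p ∣ c} θ_p`, `u = G·ρ·h` -/

section Local

variable (F : ℤ[X]) {D M : ℕ}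

/-- `1 ≤ θ_p ≤ 4D+2` and `θ_p − 1 ≤ (4D+2) ρ(p)/p` for a prime `p` with `ρ(p) ≤ D`, `ρ(p) < p`. [folklore] -/
theorem theta_bounds (hD : ∀ p : ℕ, p.Prime → polyRootCountMod ![F] p ≤ D)
    (hfix : ∀ p : ℕ, p.Prime → polyRootCountMod ![F] p < p) {p : ℕ} (hp : p.Prime) :
    1 ≤ (p : ℝ) / ((p : ℝ) - polyRootCountMod ![F] p) ∧
      (p : ℝ) / ((p : ℝ) - polyRootCountMod ![F] p) ≤ 4 * D + 2 ∧
      (p : ℝ) / ((p : ℝ) - polyRootCountMod ![F] p) - 1 ≤ (4 * D + 2) * (polyRootCountMod ![F] p : ℝ) / p := by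
  set ρ : ℕ := polyRootCountMod ![F] p
  have hρD : (ρ : ℝ) ≤ D := by exact_mod_cast hD p hp
  have hρp : (ρ : ℝ) + 1 ≤ p := by exact_mod_cast hfix p hp
  have hD0 : (0 : ℝ) ≤ D := Nat.cast_nonneg D
  have hρ0 : (0 : ℝ) ≤ ρ := Nat.cast_nonneg ρ
  have hp0 : (0 : ℝ) < p := by exact_mod_cast hp.pos
  have hsub : (0 : ℝ) < (p : ℝ) - ρ := by linarith
  have h1 : 1 ≤ (p : ℝ) / ((p : ℝ) - ρ) := by
    rw [one_le_div hsub]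
    linarith
  have h2 : (p : ℝ) / ((p : ℝ) - ρ) ≤ 4 * D + 2 := by
    rw [div_le_iff₀ hsub]
    rcases le_or_gt (2 * ρ) p with h | h
    · have h' : 2 * (ρ : ℝ) ≤ p := by exact_mod_cast h
      nlinarith [mul_nonneg hD0 hsub.le]
    · have h' : (p : ℝ) + 1 ≤ 2 * ρ := by exact_mod_cast h
      have h1' : (1 : ℝ) ≤ (p : ℝ) - ρ := by linarith
      have h4 : (0 : ℝ) ≤ 4 * D + 2 := by linarith
      nlinarith [mul_le_mul_of_nonneg_left h1' h4]
  refine ⟨h1, h2, ?_⟩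
  have h3 : (p : ℝ) / ((p : ℝ) - ρ) - 1 = (ρ : ℝ) / p * ((p : ℝ) / ((p : ℝ) - ρ)) := by
    rw [div_mul_div_comm, div_sub_one hsub.ne', sub_sub_cancel, mul_comm (p : ℝ),
      mul_div_mul_right _ _ hp0.ne']
  calc (p : ℝ) / ((p : ℝ) - ρ) - 1 = (ρ : ℝ) / p * ((p : ℝ) / ((p : ℝ) - ρ)) := h3
    _ ≤ (ρ : ℝ) / p * (4 * D + 2) := by gcongr
    _ = (4 * D + 2) * (ρ : ℝ) / p := by ring

/-- `1 ≤ h(c)`. [folklore] -/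
theorem one_le_hLoc (hD : ∀ p : ℕ, p.Prime → polyRootCountMod ![F] p ≤ D)
    (hfix : ∀ p : ℕ, p.Prime → polyRootCountMod ![F] p < p) (c : ℕ) :
    1 ≤ ∏ p ∈ c.primeFactors, (p : ℝ) / ((p : ℝ) - polyRootCountMod ![F] p) :=
  Finset.one_le_prod fun _ hp => (theta_bounds F hD hfix (Nat.prime_of_mem_primeFactors hp)).1

/-- `h(mn) = h(m) h(n)` for coprime `m, n ≠ 0`. [folklore] -/
theorem hLoc_mul {m n : ℕ} (hm : m ≠ 0) (hn : n ≠ 0) (hmn : m.Coprime n) :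
    ∏ p ∈ (m * n).primeFactors, (p : ℝ) / ((p : ℝ) - polyRootCountMod ![F] p) =
      (∏ p ∈ m.primeFactors, (p : ℝ) / ((p : ℝ) - polyRootCountMod ![F] p)) *
        ∏ p ∈ n.primeFactors, (p : ℝ) / ((p : ℝ) - polyRootCountMod ![F] p) := by
  rw [Nat.primeFactors_mul hm hn, Finset.prod_union hmn.disjoint_primeFactors]

/-- `h(p^v) = θ_p` for `v ≥ 1`. [folklore] -/
theorem hLoc_prime_pow {p : ℕ} (hp : p.Prime) {v : ℕ} (hv : 1 ≤ v) :
    ∏ q ∈ (p ^ v).primeFactors, (q : ℝ) / ((q : ℝ) - polyRootCountMod ![F] q) =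
      (p : ℝ) / ((p : ℝ) - polyRootCountMod ![F] p) := by
  rw [Nat.primeFactors_prime_pow (Nat.pos_iff_ne_zero.mp hv) hp, Finset.prod_singleton]

/-- The sieve product with the primes of `c ≠ 0` removed is at most `V(w) · h(c)` (the corrected form of
`prod_filter_not_dvd_le`, which fails for `c = 0`). [folklore] -/
theorem prod_filter_not_dvd_le (hD : ∀ p : ℕ, p.Prime → polyRootCountMod ![F] p ≤ D)
    (hfix : ∀ p : ℕ, p.Prime → polyRootCountMod ![F] p < p) {c : ℕ} (hc : c ≠ 0) (w : ℝ) :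
    ∏ p ∈ (Nat.primesBelow ⌈w⌉₊).filter (fun p => ¬ p ∣ c), (1 - (polyRootCountMod ![F] p : ℝ) / p) ≤
      (∏ p ∈ Nat.primesBelow ⌈w⌉₊, (1 - (polyRootCountMod ![F] p : ℝ) / p)) *
        ∏ p ∈ c.primeFactors, (p : ℝ) / ((p : ℝ) - polyRootCountMod ![F] p) := by
  set S : Finset ℕ := Nat.primesBelow ⌈w⌉₊
  -- positivity of the local densities `a_p = 1 - ρ(p)/p` on primes
  have ha_pos : ∀ p ∈ S, 0 < 1 - (polyRootCountMod ![F] p : ℝ) / p := by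
    intro p hp
    have hpp := Nat.prime_of_mem_primesBelow hp
    have hp0 : (0 : ℝ) < p := by exact_mod_cast hpp.pos
    have h : (polyRootCountMod ![F] p : ℝ) < p := by exact_mod_cast hfix p hpp
    rw [sub_pos, div_lt_one hp0]
    exact h
  -- the key identity `a_p · θ_p = 1`
  have hkey : ∀ p : ℕ, p.Prime →
      (1 - (polyRootCountMod ![F] p : ℝ) / p) * ((p : ℝ) / ((p : ℝ) - polyRootCountMod ![F] p)) = 1 := by
    intro p hpp
    have hp0 : (p : ℝ) ≠ 0 := by exact_mod_cast hpp.ne_zero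
    have h : (polyRootCountMod ![F] p : ℝ) < p := by exact_mod_cast hfix p hpp
    have hsub : (p : ℝ) - polyRootCountMod ![F] p ≠ 0 := (sub_pos.mpr h).ne'
    rw [one_sub_div hp0, div_mul_div_comm, mul_comm, div_self (mul_ne_zero hp0 hsub)]
  have hsplit : ∏ p ∈ S, (1 - (polyRootCountMod ![F] p : ℝ) / p) =
      (∏ p ∈ S.filter (fun p => ¬ p ∣ c), (1 - (polyRootCountMod ![F] p : ℝ) / p)) *
        ∏ p ∈ S.filter (fun p => p ∣ c), (1 - (polyRootCountMod ![F] p : ℝ) / p) :=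
    (Finset.prod_filter_not_mul_prod_filter S (fun p => p ∣ c) _).symm
  have hnonneg : 0 ≤ ∏ p ∈ S.filter (fun p => ¬ p ∣ c), (1 - (polyRootCountMod ![F] p : ℝ) / p) :=
    Finset.prod_nonneg fun p hp => (ha_pos p (Finset.mem_filter.mp hp).1).le
  rw [hsplit, mul_assoc]
  refine le_mul_of_one_le_right hnonneg ?_
  have hsub : S.filter (fun p => p ∣ c) ⊆ c.primeFactors := by
    intro p hp
    rw [Finset.mem_filter] at hp
    exact Nat.mem_primeFactors.mpr ⟨Nat.prime_of_mem_primesBelow hp.1, hp.2, hc⟩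
  have hθ1 : ∀ p ∈ c.primeFactors, 1 ≤ (p : ℝ) / ((p : ℝ) - polyRootCountMod ![F] p) :=
    fun p hp => (theta_bounds F hD hfix (Nat.prime_of_mem_primeFactors hp)).1
  calc (1 : ℝ) = ∏ p ∈ S.filter (fun p => p ∣ c),
        ((1 - (polyRootCountMod ![F] p : ℝ) / p) * ((p : ℝ) / ((p : ℝ) - polyRootCountMod ![F] p))) := by
        rw [Finset.prod_eq_one]
        intro p hp
        exact hkey p (Nat.prime_of_mem_primesBelow (Finset.mem_filter.mp hp).1)
    _ = (∏ p ∈ S.filter (fun p => p ∣ c), (1 - (polyRootCountMod ![F] p : ℝ) / p)) *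
          ∏ p ∈ S.filter (fun p => p ∣ c), ((p : ℝ) / ((p : ℝ) - polyRootCountMod ![F] p)) :=
        Finset.prod_mul_distrib
    _ ≤ (∏ p ∈ S.filter (fun p => p ∣ c), (1 - (polyRootCountMod ![F] p : ℝ) / p)) *
          ∏ p ∈ c.primeFactors, ((p : ℝ) / ((p : ℝ) - polyRootCountMod ![F] p)) :=
        mul_le_mul_of_nonneg_left
          (Finset.prod_le_prod_of_subset_of_one_le hsub
            (fun p hp => zero_le_one.trans (hθ1 p (hsub hp))) (fun p hp _ => hθ1 p hp))
          (Finset.prod_nonneg fun p hp => (ha_pos p (Finset.mem_filter.mp hp).1).le)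


end Local

/-- **Registered form** (`--supports stmt-Parity-11292`): sieve product with the primes of `c` removed: `≤ V(w) h(c)`. [folklore] -/
theorem nair_prod_filter_not_dvd_le : ∀ (F : ℤ[X]) (D : ℕ), (∀ p : ℕ, p.Prime → polyRootCountMod ![F] p ≤ D) → (∀ p : ℕ, p.Prime → polyRootCountMod ![F] p < p) → ∀ c : ℕ, c ≠ 0 → ∀ w : ℝ, ∏ p ∈ (Nat.primesBelow ⌈w⌉₊).filter (fun p => ¬ p ∣ c), (1 - (polyRootCountMod ![F] p : ℝ) / p) ≤ (∏ p ∈ Nat.primesBelow ⌈w⌉₊, (1 - (polyRootCountMod ![F] p : ℝ) / p)) * ∏ p ∈ c.primeFactors, (p : ℝ) / ((p : ℝ) - polyRootCountMod ![F] p) :=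
  fun F _D hD hfix _c hc w => prod_filter_not_dvd_le F hD hfix hc w

end

end Summit.Parity.BatemanHorn.Cruxes.SystemLSDRealSegment.BetaThinnedRootKernel.Nair
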